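import Summits.BirchSwinnertonDyer.Rank1Residual.O5.CharTwistOrthogonalityTransport
import Summits.BirchSwinnertonDyer.Rank1Residual.O5.CongruenceNumberTwistPrime
import HarnessLib

/-!
# O5 (`9 ∣ N`): ONE-WAY TRANSPORT of the congruence number under the quadratic twist across levels —
# `r(F) ∣ r(F ⊗ ψ)` for a newform `F`, and `r_G ∣ r_W` for a curve `G` and its `χ_{p*}`-twist `W`
# parametrised at levels `M ∣ N`, `p² ∣ N` (the one-way half of R-TW), as THEOREMS

HONEST FRAMING (cell `b2b-bsdres`, run/shared/lean/b2b/bsd-rank1-residual/, verbatim in every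
file): the goal of the cell is to DELETE the COMBINATION-SHAPED residual classes of the
Birch–Swinnerton-Dyer formula for ALL analytic-rank `≤ 1` elliptic curves over `ℚ` — assembled
STRICTLY from published theorems — so that the rank-`≤ 1` remainder becomes exactly the
CONSTRUCTION-SHAPED classes, which are TYPED, NOT attempted. This is not "finishing BSD". Lane
CLASS-CLOSURE, team o5 (`9 ∥ N`); planner o5-r2 GEN 7 (N3 R-TW `CongruenceNumberTwistJumpAtNine` and
`gen7/TWIN-PROOF.md`, Remark "ONE-WAY TRANSPORT: if `F` is new of level `M` with `p ∤ M` (resp. level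
`pM′`) and `f := F^χ` (new of level `p²M`, resp. `p²M′`), then `r(F) ∣ r(f)`"); typer cc-typer-5
(`O5/CongruenceNumberTwist.lean`); prover seat `b2b-bsdres-x11b3-p5` (gen. 10, cross-cell pool item
(P5-OWT)). THEOREMS ONLY (no definition, no named fact, no `sorry`); nothing booked; no RESIDUAL-MAP
mark / label / count moved; O5 OPEN; the `@[conjecture]` nodes R-TW `CongruenceNumberTwistJumpAtNine`,
R-FLAT `CongruenceDefectFlatTwinAtNine`, E-O5-CONG `CongruenceDefectLawAtNine` are UNTOUCHED and NOT
discharged.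

## What

* **`TwistTransport.congruenceNumber_dvd_congruenceNumber_charTwist` — ONE-WAY TRANSPORT for cusp
  forms**: for a newform `F ∈ S_k(Γ₀(M))` with integral coefficients, `M ∣ L`, `m² ∣ L`, `ψ` primitive
  quadratic mod `m`: `congruenceNumber F ∣ congruenceNumber (charTwist L … F)` (ARS 2012 §2.1 (ii)
  quotient `#(S_k(ℤ)/(ℤf + (ℤf)^⊥))`): `x ↦ R x` induces an INJECTION
  `S_M(ℤ)/(ℤF + F^⊥) ↪ S_L(ℤ)/(ℤ RF + (RF)^⊥)` by the orthogonality transport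
  `⟨F, z⟩ = 0 ⟺ ⟨RF, Rz⟩ = 0` (`O5/CharTwistOrthogonalityTransport.lean`), so `Nat.card ∣ Nat.card`.
  (At a COMMON level, for `p`-depleted `F`, `r` is INVARIANT: `PrimeTwist.congruenceNumber_charTwist`;
  across levels only this divisibility holds.)
* `TwistTransport.f_eq_charTwist`: for `W ≅ G ⊗ χ_{p*}` (`p` odd, `C • G.quadraticTwist (pStarRat p) = W`)
  and parametrisation data `DG` at level `M`, `DW` at level `N` with `M ∣ N`, `p² ∣ N`, the newform of
  `W` IS the twist of the newform of `G`: `DW.f = charTwist N … DG.f` (`aₙ(W) = (n/p) aₙ(G)` off `p`,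
  `LFunction_quadraticTwist_pStar_apply`; both sides vanish at `p ∣ n` — newform depletion at `p² ∣ N`).
* **`TwistTransport.congruenceNumber_dvd_of_quadraticTwist_pStar`: `congruenceNumber DG.f ∣
  congruenceNumber DW.f`** — NO reduction-type, surjectivity, minimality or conductor binder: it covers
  R-TW's `I₀*` rows (`G` good at `3`, `M = N_G`, `N = 9M`) AND its `Iₙ*` rows (`G` multiplicative at
  `3`, `M = 3M′`, `N = 9M′ = 3M`) at once, and every odd `p`.
* `TwistTransport.padicValNat_congruenceNumber_le_of_quadraticTwist_pStar`: `ord_p r_G ≤ ord_p r_W`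
  whenever `r_W ≠ 0`; at `p = 3` (twist by `−3 = 3*`): `congruenceNumber_dvd_twist_three`,
  `padicValNat_congruenceNumber_le_twist_three`.

## Reading (EVIDENCE wording; for the typer / o5-r2 to adopt or strike)

"The ONE-WAY half of R-TW `CongruenceNumberTwistJumpAtNine` is a TREE THEOREM: `r_G ∣ r_W` for every
`G` and its `χ₋₃`-twist `W` parametrised at levels `M ∣ N` with `9 ∣ N` (in particular for `G`
semistable at `3`, `M = N_G`, `N = N_W`). The node's remaining CONJECTURAL content is the reverse
bound `ord₃ r_W ≤ ord₃ r_G + [G good at 3]` together with the `+1` on the good rows. N3 / N4 /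
`CongruenceDefectLawAtNine` stay `@[conjecture]`, byte-untouched; nothing booked; no mark; O5 OPEN."
Not a Literature fact: the transport statement is a Summits theorem over the tree's proved
Atkin–Lehner–Li theory and the ARS §2.1 definition; "not found in print" (o5-r2's presearch for TWIN;
this seat's presearch: corpus fts + vec, galaxy `congruence number|congruence module|twist of a
newform` — no statement of the transport of `r` under twisting).

References: [AgasheRibetStein2012] §2.1, Thm. 2.1; [AtkinLehner1970] Thms. 3–5; [AtkinLi1978] §3;
[Shimura1971] Prop. 3.64; cell files `HOME/b2b-bsdres-o5-r2/gen7/{O5-GEN7.md §G7-3, TWIN-PROOF.md}`.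
-/
set_option autoImplicit false

noncomputable section

open scoped Classical MatrixGroups ModularForm

open CongruenceSubgroup

namespace Summit.BirchSwinnertonDyer.Rank1Residual.O5

open WeierstrassCurve Literature.NumberTheory.EllipticCurves.Rank1Residual
  Literature.NumberTheory.EllipticCurves.ModularForms

namespace TwistTransport

section CuspForms

variable {M L m : ℕ} [NeZero M] [NeZero L] [NeZero m] {k : ℤ}
  (hML : M ∣ L) (hm : m ^ 2 ∣ L) {ψ : DirichletCharacter ℂ m} (hψ : ψ.IsQuadratic)

include hψ in
omit [NeZero m] in
/-- A quadratic character takes integer values: `ψ(a) ∈ {0, 1, -1} ⊆ ℤ`. [folklore] -/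
theorem exists_intCast_eq_apply (a : ZMod m) : ∃ z : ℤ, (z : ℂ) = ψ a := by
  rcases hψ a with h | h | h
  · exact ⟨0, by rw [h, Int.cast_zero]⟩
  · exact ⟨1, by rw [h, Int.cast_one]⟩
  · exact ⟨-1, by rw [h, Int.cast_neg, Int.cast_one]⟩

/-- The twist maps `S_k(Γ₀(M); ℤ)` into `S_k(Γ₀(L); ℤ)` (`ψ(n) ∈ {0, ±1}`). [folklore] -/
theorem charTwist_mem_integralCuspForms0 (hprim : ψ.IsPrimitive) {f : CuspForm (Gamma0 M) k}
    (hf : f ∈ integralCuspForms0 M k) : charTwist L hML hm hψ f ∈ integralCuspForms0 L k := by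
  intro n
  obtain ⟨a, ha⟩ := hf n
  obtain ⟨z, hz⟩ := exists_intCast_eq_apply hψ (n : ZMod m)
  exact ⟨z * a, by rw [cuspCoeff_charTwist L hML hm hψ hprim, Int.cast_mul, hz, ha]⟩

/-- **`R` maps `ℤF + (ℤF)^⊥` into `ℤ(RF) + (ℤ RF)^⊥`** for a newform `F` (orthogonality transport
`peterssonProduct_eq_zero_iff_charTwist` + integrality `charTwist_mem_integralCuspForms0`).
[cite: AgasheRibetStein2012, §2.1] -/
theorem charTwist_mem_sup (hprim : ψ.IsPrimitive) {F : CuspForm (Gamma0 M) k} (hF : IsNewform0 F)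
    {x : CuspForm (Gamma0 M) k} (hx : x ∈ (ℤ ∙ F) ⊔ integralOrthogonal0 F) :
    charTwist L hML hm hψ x ∈
      (ℤ ∙ charTwist L hML hm hψ F) ⊔ integralOrthogonal0 (charTwist L hML hm hψ F) := by
  obtain ⟨a, ha, b, hb, rfl⟩ := Submodule.mem_sup.mp hx
  obtain ⟨z, rfl⟩ := Submodule.mem_span_singleton.mp ha
  rw [mem_integralOrthogonal0] at hb
  rw [charTwist_add hML hm hψ hprim, charTwist_zsmul hML hm hψ hprim]
  refine Submodule.add_mem _ (Submodule.mem_sup_left (Submodule.mem_span_singleton.mpr ⟨z, rfl⟩))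
    (Submodule.mem_sup_right ?_)
  rw [mem_integralOrthogonal0]
  exact ⟨charTwist_mem_integralCuspForms0 hML hm hψ hprim hb.1,
    (peterssonProduct_eq_zero_iff_charTwist hML hm hψ hprim hF b).mp hb.2⟩

/-- **One-way transport of the congruence number** (Agashe–Ribet–Stein 2012, §2.1 (ii); mechanism
of Atkin–Lehner 1970 Thms. 4–5 / Atkin–Li 1978 §3): for a newform `F ∈ S_k(Γ₀(M))` with integral
Fourier coefficients, `M ∣ L`, `m² ∣ L`, `ψ` primitive quadratic mod `m`, `R = charTwist L …`:
**`congruenceNumber F ∣ congruenceNumber (R F)`** — `x ↦ R x` induces a homomorphism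
`S_M(ℤ)/(ℤF + F^⊥) → S_L(ℤ)/(ℤ RF + (RF)^⊥)` (`charTwist_mem_sup`), INJECTIVE by
`peterssonProduct_eq_zero_iff_charTwist` (`R x = z·RF + y`, `y ⊥ RF` ⇒ `x − zF ⊥ F`), and an
injection of groups makes `Nat.card` divide `Nat.card`. Equality needs `R` invertible (same level,
`p`-depleted `F`: Summits `O5/CongruenceNumberTwistPrime.lean`); across levels only this divisibility.
[cite: AgasheRibetStein2012, §2.1] [cite: AtkinLehner1970, Thms. 4–5] [cite: AtkinLi1978, §3] -/
theorem congruenceNumber_dvd_congruenceNumber_charTwist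
    (hprim : ψ.IsPrimitive) {F : CuspForm (Gamma0 M) k} (hF : IsNewform0 F)
    (hFi : F ∈ integralCuspForms0 M k) :
    congruenceNumber F ∣ congruenceNumber (charTwist L hML hm hψ F) := by
  set SM := integralCuspForms0 M k with hSM
  set SL := integralCuspForms0 L k with hSL
  set f := charTwist L hML hm hψ F with hf
  let φ : SM →ₗ[ℤ] SL :=
    { toFun := fun x ↦ ⟨charTwist L hML hm hψ x, charTwist_mem_integralCuspForms0 hML hm hψ hprim x.2⟩
      map_add' := fun x y ↦ Subtype.ext (charTwist_add hML hm hψ hprim (x : CuspForm (Gamma0 M) k) y)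
      map_smul' := fun z x ↦ Subtype.ext (charTwist_zsmul hML hm hψ hprim z (x : CuspForm (Gamma0 M) k)) }
  have hφ : ∀ x : SM, ((φ x : SL) : CuspForm (Gamma0 L) k) = charTwist L hML hm hψ x := fun _ ↦ rfl
  set HF : Submodule ℤ SM := ((ℤ ∙ F) ⊔ integralOrthogonal0 F).comap SM.subtype with hHF
  set Hf : Submodule ℤ SL := ((ℤ ∙ f) ⊔ integralOrthogonal0 f).comap SL.subtype with hHf
  have hle : HF ≤ Hf.comap φ := by
    intro x hx
    rw [Submodule.mem_comap, hHf, Submodule.mem_comap, Submodule.subtype_apply, hφ]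
    rw [hHF, Submodule.mem_comap, Submodule.subtype_apply] at hx
    exact charTwist_mem_sup hML hm hψ hprim hF hx
  let Ψ : (SM ⧸ HF) →ₗ[ℤ] (SL ⧸ Hf) := HF.mapQ Hf φ hle
  have hΨ : ∀ x : SM, Ψ (Submodule.Quotient.mk x) = Submodule.Quotient.mk (φ x) := fun _ ↦ rfl
  have hinj : Function.Injective Ψ := by
    rw [← LinearMap.ker_eq_bot, LinearMap.ker_eq_bot']
    intro q hq
    obtain ⟨x, rfl⟩ := Submodule.Quotient.mk_surjective HF q
    rw [hΨ, Submodule.Quotient.mk_eq_zero, hHf, Submodule.mem_comap, Submodule.subtype_apply, hφ] at hq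
    rw [Submodule.Quotient.mk_eq_zero, hHF, Submodule.mem_comap, Submodule.subtype_apply]
    obtain ⟨a, ha, y, hy, hay⟩ := Submodule.mem_sup.mp hq
    obtain ⟨z, rfl⟩ := Submodule.mem_span_singleton.mp ha
    rw [mem_integralOrthogonal0] at hy
    -- `x = z F + (x - z F)` with `x - z F ∈ (ℤF)^⊥`
    have hb : (x : CuspForm (Gamma0 M) k) - z • F ∈ integralOrthogonal0 F := by
      rw [mem_integralOrthogonal0]
      refine ⟨Submodule.sub_mem _ x.2 (Submodule.smul_mem _ z hFi), ?_⟩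
      rw [peterssonProduct_eq_zero_iff_charTwist hML hm hψ hprim hF, charTwist_sub hML hm hψ hprim,
        charTwist_zsmul hML hm hψ hprim, ← hf, ← hay, add_sub_cancel_left]
      exact hy.2
    have hx' : (x : CuspForm (Gamma0 M) k) = z • F + ((x : CuspForm (Gamma0 M) k) - z • F) := by abel
    rw [hx']
    exact Submodule.add_mem _ (Submodule.mem_sup_left (Submodule.mem_span_singleton.mpr ⟨z, rfl⟩))
      (Submodule.mem_sup_right hb)
  rw [congruenceNumber_def, congruenceNumber_def]
  exact AddSubgroup.card_dvd_of_injective Ψ.toAddMonoidHom hinj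

end CuspForms

variable {p : ℕ} [hp : Fact p.Prime] {M N : ℕ} [NeZero M] [NeZero N]
  {G W : WeierstrassCurve ℚ} [G.IsElliptic]

/-- **The newform of the twist is the twist of the newform, across levels**: for `p` odd,
`W = C • (G ⊗ χ_{p*})`, `DG` at level `M`, `DW` at level `N`, `M ∣ N`, `p² ∣ N`:
`DW.f = R DG.f` with `R = charTwist N …` by `(·/p) ⊗ ℂ` — coefficientwise `aₙ(W) = (n/p)·aₙ(G)` for
`p ∤ n` (`LFunction_quadraticTwist_pStar_apply`, `LFunction_smul`) and `aₙ(W) = 0 = (n/p)` for `p ∣ n`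
(newform of level `p² ∣ N`). [cite: Shimura1971, Prop. 3.64] [cite: AtkinLehner1970, Thm. 3] -/
theorem f_eq_charTwist (hMN : M ∣ N) (hpN : p ^ 2 ∣ N) (hp2 : p ≠ 2) (C : VariableChange ℚ)
    (hC : C • G.quadraticTwist (pStarRat p) = W) (DG : ModularParametrizationData G M)
    (DW : ModularParametrizationData W N) :
    DW.f = charTwist N hMN hpN (isQuadratic_quadraticChar_ringHomComp p) DG.f := by
  have hprim := isPrimitive_quadraticChar_ringHomComp p hp2
  have hd0 : pStarRat p ≠ 0 := by
    unfold pStarRat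
    push_cast
    exact mul_ne_zero (pow_ne_zero _ (by norm_num)) (by exact_mod_cast hp.out.ne_zero)
  haveI : (G.quadraticTwist (pStarRat p)).IsElliptic := G.isElliptic_quadraticTwist hd0
  refine eq_of_forall_cuspCoeff_eq_gamma0 fun n ↦ ?_
  rw [cuspCoeff_charTwist N hMN hpN _ hprim, quadraticChar_ringHomComp_apply_natCast]
  by_cases hn : p ∣ n
  · rw [PrimeTwist.cuspCoeff_eq_zero_of_prime_dvd_of_isNewform0 hpN DW.isNewformOf.1 hn,
      (legendreSym.eq_zero_iff p n).mpr (by exact_mod_cast (ZMod.natCast_eq_zero_iff n p).mpr hn)]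
    push_cast
    ring
  · rw [DW.isNewformOf.2 n, DG.isNewformOf.2 n, ← hC, WeierstrassCurve.LFunction_smul, pStarRat,
      G.LFunction_quadraticTwist_pStar_apply hp2 hn]
    push_cast
    ring

/-- **ONE-WAY TRANSPORT `r_G ∣ r_W`** (o5-r2 TWIN-PROOF Remark; Agashe–Ribet–Stein 2012 §2.1
quotient): for `p` odd, `W = C • (G ⊗ χ_{p*})`, parametrisation data `DG` at level `M` and `DW` at
level `N` with `M ∣ N`, `p² ∣ N`: `congruenceNumber DG.f ∣ congruenceNumber DW.f`. No reduction /
surjectivity / minimality / conductor hypothesis (so both the `I₀*` rows `N = p²M` and the `Iₙ*`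
rows `M = pM′`, `N = p²M′` of R-TW are covered). The Literature leaf
`IsNewform0.congruenceNumber_dvd_congruenceNumber_charTwist` applied to `F = DG.f`
(`f_eq_charTwist`). [cite: AgasheRibetStein2012, §2.1] [cite: AtkinLehner1970, Thms. 4–5] -/
theorem congruenceNumber_dvd_of_quadraticTwist_pStar (hMN : M ∣ N) (hpN : p ^ 2 ∣ N) (hp2 : p ≠ 2)
    (C : VariableChange ℚ) (hC : C • G.quadraticTwist (pStarRat p) = W)
    (DG : ModularParametrizationData G M) (DW : ModularParametrizationData W N) :
    congruenceNumber DG.f ∣ congruenceNumber DW.f := by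
  rw [f_eq_charTwist hMN hpN hp2 C hC DG DW]
  exact congruenceNumber_dvd_congruenceNumber_charTwist hMN hpN _
    (isPrimitive_quadraticChar_ringHomComp p hp2) DG.isNewformOf.1 DG.f_mem_integralCuspForms0

/-- **`ord_p r_G ≤ ord_p r_W`** whenever `r_W ≠ 0` (the `p`-adic reading of the one-way transport).
[cite: AgasheRibetStein2012, §2.1] -/
theorem padicValNat_congruenceNumber_le_of_quadraticTwist_pStar (hMN : M ∣ N) (hpN : p ^ 2 ∣ N)
    (hp2 : p ≠ 2) (C : VariableChange ℚ) (hC : C • G.quadraticTwist (pStarRat p) = W)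
    (DG : ModularParametrizationData G M) (DW : ModularParametrizationData W N)
    (hr : congruenceNumber DW.f ≠ 0) :
    padicValNat p (congruenceNumber DG.f) ≤ padicValNat p (congruenceNumber DW.f) :=
  (padicValNat_dvd_iff_le hr).mp
    (pow_padicValNat_dvd.trans (congruenceNumber_dvd_of_quadraticTwist_pStar hMN hpN hp2 C hC DG DW))

end TwistTransport

/-! ### The `p = 3` reading in the setting of R-TW `CongruenceNumberTwistJumpAtNine` -/

section Three

variable {M N : ℕ} [NeZero M] [NeZero N] {G W : WeierstrassCurve ℚ} [G.IsElliptic]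

/-- **One-way half of R-TW at `p = 3`: `r_G ∣ r_W`** for `W = C • (G ⊗ χ₋₃)` and parametrisation data
at levels `M ∣ N`, `9 ∣ N` — e.g. `G` semistable at `3` of conductor `M`, `W` of conductor `N = 9M`
(`I₀*`) or `N = 3M` (`Iₙ*`, `M = 3M′`) as in `O5.CongruenceNumberTwistJumpAtNine`, whose further binders
(`IsGloballyMinimal`, conductor equalities, reduction type, `HasSurjectiveModNGaloisRep 3`) are NOT
needed for this half. The node itself (the EXACT jump) is untouched. [cite: AgasheRibetStein2012, §2.1] -/
theorem congruenceNumber_dvd_twist_three (hMN : M ∣ N) (h9 : 9 ∣ N) (C : VariableChange ℚ)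
    (hC : C • G.quadraticTwist (-3) = W) (DG : ModularParametrizationData G M)
    (DW : ModularParametrizationData W N) : congruenceNumber DG.f ∣ congruenceNumber DW.f := by
  haveI : Fact (Nat.Prime 3) := ⟨Nat.prime_three⟩
  have hC' : C • G.quadraticTwist (pStarRat 3) = W := by rwa [pStarRat_three]
  exact TwistTransport.congruenceNumber_dvd_of_quadraticTwist_pStar hMN (by simpa using h9)
    (by norm_num) C hC' DG DW

/-- **`ord₃ r_G ≤ ord₃ r_W`** in the same setting, whenever `r_W ≠ 0` — the inequality that the
one-way half of R-TW contributes (R-TW predicts `=` on `Iₙ*` rows and `ord₃ r_W = ord₃ r_G + 1` on `I₀*`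
rows; the reverse bound and the `+1` remain conjectural). [cite: AgasheRibetStein2012, §2.1] -/
theorem padicValNat_congruenceNumber_le_twist_three (hMN : M ∣ N) (h9 : 9 ∣ N) (C : VariableChange ℚ)
    (hC : C • G.quadraticTwist (-3) = W) (DG : ModularParametrizationData G M)
    (DW : ModularParametrizationData W N) (hr : congruenceNumber DW.f ≠ 0) :
    padicValNat 3 (congruenceNumber DG.f) ≤ padicValNat 3 (congruenceNumber DW.f) := by
  haveI : Fact (Nat.Prime 3) := ⟨Nat.prime_three⟩
  exact (padicValNat_dvd_iff_le hr).mp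
    (pow_padicValNat_dvd.trans (congruenceNumber_dvd_twist_three hMN h9 C hC DG DW))

end Three

end Summit.BirchSwinnertonDyer.Rank1Residual.O5
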